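import Summits.AnomalousDissipation.AnomalousDissipation.Theorems.MomentParityResolvedDissipationGalerkinEEaeWindow
import Literature.Analysis.FluidPDE.PassiveScalarEnergySobolev
import HarnessLib

/-!
# TUI ⟹ GEE₀ᵃᵉ, part 2: windows, good times, chaining — the registered stub S14
# (crux `MomentParity.ResolvedDissipation`, stmt-AnomalousDissipation-14284; line `enstrophy-ui-transfer`, lead c7)

Supports stmt-AnomalousDissipation-14284 (registered stub S14 `stub_galerkinEEaeOfTrajectoryUI` of skeleton v8). Nothing
here closes an item. Part 1 (`…GalerkinEEaeWindow.lean`) proves that on a TUI window after a bounded-enstrophy restart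
the dissipation integrals of a Hopf–Galerkin family do not overshoot, hence converge, hence the limit satisfies the
energy equality between strong times. Here: the window statement between two GOOD times (strong `L²` convergence +
`liminf ‖∇U n‖² < ∞` at the restart time; `energyEq_window`), good times are a.e. (`ae_liminf_eGradNormSq_lt_top` — Fatou,
with `Literature.Analysis.FluidPDE.aemeasurable_liminf_nat`,
with the `N`-uniform dissipation budget — and `exists_strictMono_ae_tendsto_eLpNorm`), the energy equality is additive
(`energyEq_trans`) and windows chain along the a.e.-dense good times (`chain_of_window`); `energyEq_ae_horizon` assembles
the statement below a fixed horizon and the stub takes the horizons `T = m + 1`.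

Net effect on the map of the crux (all arrows tree theorems): GEE ⟹ GEE₀ᵃᵉ ⟺ TUI ⟹ U ⟺ RD, where GEE₀ᵃᵉ = energy
equality between a.e. pairs of positive times for coefficientwise limits of Hopf–Galerkin families of NS(ν, f) with the
exact steady force and mean-zero data (⟸ is `TrajectoryUIOfGalerkinEEae.stub_trajectoryUIOfGalerkinEEae`, S13).

References: FMRT 2001 Ch. IV (1.31); Robinson–Rodrigo–Sadowski 2016 Thm 4.4, Thm 4.6.
-/

noncomputable section

-- `Summit.<Summit>.<Problem>`: single-conjunct summit, the duplicate namespace segment is mandated.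
set_option linter.dupNamespace false

namespace Summit.AnomalousDissipation.AnomalousDissipation.Theorems.MomentParityResolvedDissipation.GalerkinEEaeOfTUI

open MeasureTheory Filter Topology Set UnitAddTorus
open scoped ENNReal InnerProductSpace RealInnerProductSpace BigOperators
open Literature.Analysis.FunctionSpaces Literature.Analysis.FunctionSpaces.Torus
open Literature.Analysis.FluidPDE Literature.Analysis.FluidPDE.Torus
open Summit.AnomalousDissipation.AnomalousDissipation.Theorems.CubicParityLoud.Negative (T3 R3)
open Summit.AnomalousDissipation.AnomalousDissipation.Theorems.MomentParity (lintegral_force_lt_top)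
open Summit.AnomalousDissipation.AnomalousDissipation.Theorems.UniformResolution.Negative
  (eLapNormSq tailGradNormSq_mul_le_eLapNormSq eGradNormSq_eq_fourierTruncate_add_tail)

/-! ## Lemma D — the energy equality on a TUI window between two good times -/

/-- **Energy equality on a window (lead c7).** In the setting of `limsup_lintegral_le_of_trajectoryUI`, let
`0 ≤ p ≤ q ≤ p + T₀`, `q ≤ Tb`, be two times of strong `L²` convergence such that the enstrophies at the
restart time `p` do not all diverge, `liminf_n ‖∇U n p‖² < ∞`. Then the limit satisfies the energy equality on
`[p, q]`: pass to a subsequence with `‖∇U n p‖² ≤ G` (`Filter.extraction_of_frequently_atTop`), apply Lemma A to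
the sub-family (`IsHopfGalerkinFamily.comp_strictMono`) and Lemma B/C. -/
theorem energyEq_window {ν : ℝ} (hν : 0 < ν) {f : T3 → R3} (hf : IsSmooth f) (hf0 : HasZeroMean f)
    {u₀ : T3 → R3} (hu₀ : MemLp u₀ 2 volume) {N : ℕ → ℕ} {U : ℕ → ℝ → T3 → R3} {u : ℝ → T3 → R3}
    (hF : IsHopfGalerkinFamily ν (fun _ => f) u₀ N (fun _ _ => f) U) (hmean : ∀ n, HasZeroMean (U n 0))
    (hum : AEStronglyMeasurable (stLift u) (volume.restrict (Ioi (0 : ℝ) ×ˢ univ)))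
    (hu : ∀ t, 0 ≤ t → MemLp (u t) 2 volume)
    (hcv : ∀ t, 0 ≤ t → ∀ k, Tendsto (fun n => mFourierCoeff (EuclideanSpace.complexify ∘ U n t) k) atTop
      (𝓝 (mFourierCoeff (EuclideanSpace.complexify ∘ u t) k)))
    {Tb R' : ℝ} (hR' : ∀ n t, 0 ≤ t → t ≤ Tb → ∫ x, ‖U n t x‖ ^ 2 ≤ R' ^ 2) {T₀ : ℝ} (hT₀ : 0 < T₀)
    (hTUI : ∀ G : ℝ≥0∞, G ≠ ⊤ → ∀ ε : ℝ≥0∞, 0 < ε → ∃ M : ℝ≥0∞, M ≠ ⊤ ∧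
      ∀ (N : ℕ) (a : T3 → R3), IsGalerkinMode N a → HasZeroMean a → ∫ x, ‖a x‖ ^ 2 ≤ R' ^ 2 →
        eGradNormSq a ≤ G →
        ∫⁻ t in Ioo 0 T₀, (Ioi M).indicator id (eGradNormSq (galerkinFlow ν f N t a)) ≤ ε)
    {p q : ℝ} (hp : 0 ≤ p) (hpq : p ≤ q) (hqT₀ : q ≤ p + T₀) (hqTb : q ≤ Tb)
    (hsp : Tendsto (fun n => eLpNorm (U n p - u p) 2 volume) atTop (𝓝 0))
    (hsq : Tendsto (fun n => eLpNorm (U n q - u q) 2 volume) atTop (𝓝 0))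
    (hfin : liminf (fun n => eGradNormSq (U n p)) atTop < ⊤) :
    kineticEnergy (u q) + ν * (∫⁻ τ in Ioo p q, eGradNormSq (u τ)).toReal =
      kineticEnergy (u p) + ∫ τ in p..q, ∫ x, ⟪f x, u τ x⟫_ℝ := by
  -- a subsequence along which the restart enstrophies are bounded
  set G : ℝ≥0∞ := liminf (fun n => eGradNormSq (U n p)) atTop + 1 with hGdef
  have hG : G ≠ ⊤ := ENNReal.add_ne_top.2 ⟨hfin.ne, ENNReal.one_ne_top⟩
  have hlt : liminf (fun n => eGradNormSq (U n p)) atTop < G := ENNReal.lt_add_right hfin.ne one_ne_zero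
  obtain ⟨ψ, hψ, hψG⟩ := extraction_of_frequently_atTop
    (frequently_lt_of_liminf_lt (f := atTop) (u := fun n => eGradNormSq (U n p)) (h := hlt))
  have hF' := hF.comp_strictMono hψ
  have hcv' : ∀ t, 0 ≤ t → ∀ k, Tendsto (fun n => mFourierCoeff (EuclideanSpace.complexify ∘ (U ∘ ψ) n t) k)
      atTop (𝓝 (mFourierCoeff (EuclideanSpace.complexify ∘ u t) k)) :=
    fun t ht k => (hcv t ht k).comp hψ.tendsto_atTop
  have hsup := limsup_lintegral_le_of_trajectoryUI hν hf hf0 hF' (fun n => hmean (ψ n)) hu hcv'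
    (fun n t ht htb => hR' (ψ n) t ht htb) hT₀ hTUI hp hG (fun n => le_of_lt (hψG n)) hpq hqT₀ hqTb
  exact energyEq_of_limsup_le hν hf hu₀ hF' hum hu hcv' hp hpq (hsp.comp hψ.tendsto_atTop)
    (hsq.comp hψ.tendsto_atTop) hsup

/-! ## Lemma E — good restart times are almost all times -/

/-- **At almost every time the Galerkin enstrophies do not all diverge**: along a Hopf–Galerkin family with the
exact steady smooth force, `liminf_n ‖∇U n s‖² < ∞` for a.e. `s ∈ (0, T)` — Fatou (`lintegral_liminf_le'`) with the
`N`-uniform dissipation budget `IsHopfGalerkinFamily.lintegral_eGradNormSq_le`. [folklore] -/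
theorem ae_liminf_eGradNormSq_lt_top {ν : ℝ} (hν : 0 < ν) {f : T3 → R3} (hf : IsSmooth f)
    {u₀ : T3 → R3} (hu₀ : MemLp u₀ 2 volume) {N : ℕ → ℕ} {U : ℕ → ℝ → T3 → R3}
    (hF : IsHopfGalerkinFamily ν (fun _ => f) u₀ N (fun _ _ => f) U) {T : ℝ} (hT : 0 < T) :
    ∀ᵐ s ∂(volume.restrict (Ioo 0 T)), liminf (fun n => eGradNormSq (U n s)) atTop < ⊤ := by
  have hfm := Literature.Analysis.FluidPDE.aestronglyMeasurable_stLift_const hf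
    (volume.restrict (Ioi (0 : ℝ) ×ˢ univ))
  have hf₂ : ∀ T : ℝ, 0 < T → ∫⁻ _ in Ioo (0 : ℝ) T, ∫⁻ x, ‖f x‖ₑ ^ 2 < ⊤ := fun T _ =>
    lintegral_force_lt_top hf T
  obtain ⟨A, hA, hFA⟩ := hF.exists_force_bound hfm hf₂ hT
  have hmeas : ∀ n, AEMeasurable (fun s => eGradNormSq (U n s)) (volume.restrict (Ioo 0 T)) := fun n =>
    hF.aemeasurable_eGradNormSq n T
  refine ae_lt_top' (aemeasurable_liminf_nat hmeas) (ne_top_of_le_ne_top (ENNReal.ofReal_ne_top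
    (r := ((∫ x, ‖u₀ x‖ ^ 2) + 2 * T * A.toReal) / ν)) ?_)
  calc ∫⁻ s in Ioo 0 T, liminf (fun n => eGradNormSq (U n s)) atTop
      ≤ liminf (fun n => ∫⁻ s in Ioo 0 T, eGradNormSq (U n s)) atTop := lintegral_liminf_le' hmeas
    _ ≤ ENNReal.ofReal (((∫ x, ‖u₀ x‖ ^ 2) + 2 * T * A.toReal) / ν) :=
        liminf_le_of_frequently_le'
          (Frequently.of_forall fun n => hF.lintegral_eGradNormSq_le hν hu₀ hT hA n (hFA n))

/-! ## Lemma H — additivity of the energy equality over adjacent intervals -/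

/-- **The energy equality is additive over adjacent intervals**: if it holds on `[p, r]` and on `[r, q]` (finite
dissipation on `(p, q)`, integrable work), it holds on `[p, q]` (`Ioo p q = Ioc p r ∪ Ioo r q` up to null sets,
`intervalIntegral.integral_add_adjacent_intervals`). [folklore] -/
theorem energyEq_trans {ν : ℝ} {f : T3 → R3} {u : ℝ → T3 → R3} {p r q : ℝ} (hpr : p ≤ r) (hrq : r ≤ q)
    (hfin : ∫⁻ τ in Ioo p q, eGradNormSq (u τ) ≠ ⊤)
    (hWpr : IntervalIntegrable (fun τ => ∫ x, ⟪f x, u τ x⟫_ℝ) volume p r)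
    (hWrq : IntervalIntegrable (fun τ => ∫ x, ⟪f x, u τ x⟫_ℝ) volume r q)
    (h₁ : kineticEnergy (u r) + ν * (∫⁻ τ in Ioo p r, eGradNormSq (u τ)).toReal =
      kineticEnergy (u p) + ∫ τ in p..r, ∫ x, ⟪f x, u τ x⟫_ℝ)
    (h₂ : kineticEnergy (u q) + ν * (∫⁻ τ in Ioo r q, eGradNormSq (u τ)).toReal =
      kineticEnergy (u r) + ∫ τ in r..q, ∫ x, ⟪f x, u τ x⟫_ℝ) :
    kineticEnergy (u q) + ν * (∫⁻ τ in Ioo p q, eGradNormSq (u τ)).toReal =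
      kineticEnergy (u p) + ∫ τ in p..q, ∫ x, ⟪f x, u τ x⟫_ℝ := by
  -- splitting of the dissipation integral
  have hIoo : ∀ a b : ℝ, ∫⁻ τ in Ioo a b, eGradNormSq (u τ) = ∫⁻ τ in Ioc a b, eGradNormSq (u τ) := fun a b =>
    setLIntegral_congr Ioo_ae_eq_Ioc
  have hsplit : ∫⁻ τ in Ioo p q, eGradNormSq (u τ) =
      (∫⁻ τ in Ioo p r, eGradNormSq (u τ)) + ∫⁻ τ in Ioo r q, eGradNormSq (u τ) := by
    rw [hIoo p q, hIoo p r, hIoo r q, ← Ioc_union_Ioc_eq_Ioc hpr hrq,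
      lintegral_union measurableSet_Ioc (Ioc_disjoint_Ioc_of_le le_rfl)]
  have h1top : ∫⁻ τ in Ioo p r, eGradNormSq (u τ) ≠ ⊤ :=
    ne_top_of_le_ne_top hfin (hsplit ▸ le_self_add)
  have h2top : ∫⁻ τ in Ioo r q, eGradNormSq (u τ) ≠ ⊤ :=
    ne_top_of_le_ne_top hfin (hsplit ▸ le_add_self)
  rw [hsplit, ENNReal.toReal_add h1top h2top, ← intervalIntegral.integral_add_adjacent_intervals hWpr hWrq]
  linear_combination h₁ + h₂

/-! ## Lemma F — chaining windows along an a.e.-dense set of good times -/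

/-- **Chaining.** Let `P` hold at a.e. point of `(a, b)` and only at points of `(a, b)`, let the relation `E` hold
for all `P`-pairs at distance `≤ T₀` (`T₀ > 0`) and be transitive through intermediate points. Then `E` holds for
ALL ordered `P`-pairs: peel off a window `(q − T₀, q − T₀/2)`, which contains a `P`-point because `P` has full
measure. [folklore] -/
theorem chain_of_window {P : ℝ → Prop} {E : ℝ → ℝ → Prop} {a b T₀ : ℝ} (hT₀ : 0 < T₀)
    (hP : ∀ᵐ s ∂(volume.restrict (Ioo a b)), P s) (hPmem : ∀ s, P s → s ∈ Ioo a b)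
    (hwin : ∀ p q, P p → P q → p ≤ q → q ≤ p + T₀ → E p q)
    (htrans : ∀ p r q, P p → P r → P q → p ≤ r → r ≤ q → E p r → E r q → E p q) :
    ∀ p q, P p → P q → p ≤ q → E p q := by
  -- a `P`-point in every non-trivial subinterval
  have hpick : ∀ α β : ℝ, a ≤ α → α < β → β ≤ b → ∃ r, P r ∧ r ∈ Ioo α β := by
    intro α β hα hαβ hβ
    have hsub : Ioo α β ⊆ Ioo a b := Ioo_subset_Ioo hα hβ
    have hP' := ae_restrict_of_ae_restrict_of_subset hsub hP
    have hne : NeBot (ae (volume.restrict (Ioo α β))) := by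
      rw [ae_neBot, Ne, Measure.restrict_eq_zero, Real.volume_Ioo, ENNReal.ofReal_eq_zero, not_le]
      linarith
    exact (hP'.and (ae_restrict_mem measurableSet_Ioo)).exists
  -- induction on the number of half-windows
  have key : ∀ m : ℕ, ∀ p q, P p → P q → p ≤ q → q - p ≤ T₀ + m * (T₀ / 2) → E p q := by
    intro m
    induction m with
    | zero =>
        intro p q hPp hPq hpq hd
        exact hwin p q hPp hPq hpq (by push_cast at hd; linarith)
    | succ m ih =>
        intro p q hPp hPq hpq hd
        by_cases h : q - p ≤ T₀ + m * (T₀ / 2)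
        · exact ih p q hPp hPq hpq h
        · push Not at h
          have hpa := (hPmem p hPp).1
          have hqb := (hPmem q hPq).2
          have hqp : p < q - T₀ := by
            have : (0 : ℝ) ≤ m * (T₀ / 2) := by positivity
            linarith
          obtain ⟨r, hPr, hr⟩ := hpick (q - T₀) (q - T₀ / 2) (by linarith) (by linarith) (by linarith)
          have hpr : p ≤ r := by linarith [hr.1]
          have hrq : r ≤ q := by linarith [hr.2]
          refine htrans p r q hPp hPr hPq hpr hrq (ih p r hPp hPr hpr ?_) (hwin r q hPr hPq hrq (by linarith [hr.1]))
          push_cast at hd ⊢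
          linarith [hr.2]
  intro p q hPp hPq hpq
  obtain ⟨m, hm⟩ : ∃ m : ℕ, q - p ≤ T₀ + m * (T₀ / 2) := by
    refine ⟨⌈(q - p) / (T₀ / 2)⌉₊, ?_⟩
    have h1 : (q - p) / (T₀ / 2) ≤ ⌈(q - p) / (T₀ / 2)⌉₊ := Nat.le_ceil _
    have h2 : q - p ≤ ⌈(q - p) / (T₀ / 2)⌉₊ * (T₀ / 2) := by
      rwa [div_le_iff₀ (by positivity)] at h1
    linarith
  exact key m p q hPp hPq hpq hm


/-! ## Lemma G — the energy equality between a.e. pairs of times below a fixed horizon -/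

/-- **TUI ⟹ energy equality between a.e. pairs of times of `(0, T)` (lead c7).** For a Hopf–Galerkin family of
NS(ν, f) with the exact steady smooth mean-zero force and mean-zero data, converging coefficientwise to `u`, and a
horizon `T > 0`: along the subsequence of `exists_strictMono_ae_tendsto_eLpNorm` a.e. time of `(0, T)` is GOOD (strong
`L²` convergence and `liminf_n ‖∇U n s‖² < ∞`, Lemma E); TUI at the radius `R'` of the `L²`-ball containing all slices
up to time `T` (`integral_norm_sq_le`) gives a window `T₀`; good pairs at distance `≤ T₀` satisfy the energy equality
(Lemma D) and windows chain along good times (Lemmas F, H). -/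
theorem energyEq_ae_horizon {ν : ℝ} (hν : 0 < ν) {f : T3 → R3} (hf : IsSmooth f) (hf0 : HasZeroMean f)
    (hTUI : ∀ R : ℝ, ∃ T : ℝ, 0 < T ∧
      ∀ G : ℝ≥0∞, G ≠ ⊤ → ∀ ε : ℝ≥0∞, 0 < ε → ∃ M : ℝ≥0∞, M ≠ ⊤ ∧
        ∀ (N : ℕ) (a : T3 → R3), IsGalerkinMode N a → HasZeroMean a → ∫ x, ‖a x‖ ^ 2 ≤ R ^ 2 →
          eGradNormSq a ≤ G →
          ∫⁻ t in Ioo 0 T, (Ioi M).indicator id (eGradNormSq (galerkinFlow ν f N t a)) ≤ ε)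
    {u₀ : T3 → R3} (hu₀ : MemLp u₀ 2 volume) {N : ℕ → ℕ} {U : ℕ → ℝ → T3 → R3} {u : ℝ → T3 → R3}
    (hF : IsHopfGalerkinFamily ν (fun _ => f) u₀ N (fun _ _ => f) U) (hmean : ∀ n, HasZeroMean (U n 0))
    (hum : AEStronglyMeasurable (stLift u) (volume.restrict (Ioi (0 : ℝ) ×ˢ univ)))
    (hu : ∀ t, 0 ≤ t → MemLp (u t) 2 volume)
    (hcv : ∀ t, 0 ≤ t → ∀ k, Tendsto (fun n => mFourierCoeff (EuclideanSpace.complexify ∘ U n t) k) atTop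
      (𝓝 (mFourierCoeff (EuclideanSpace.complexify ∘ u t) k)))
    {T : ℝ} (hT : 0 < T) :
    ∀ᵐ t₀ ∂(volume.restrict (Ioo 0 T)), ∀ᵐ t₁ ∂(volume.restrict (Ioo 0 T)), t₀ ≤ t₁ →
      kineticEnergy (u t₁) + ν * (∫⁻ τ in Ioo t₀ t₁, eGradNormSq (u τ)).toReal =
        kineticEnergy (u t₀) + ∫ τ in t₀..t₁, ∫ x, ⟪f x, u τ x⟫_ℝ := by
  have hfm := Literature.Analysis.FluidPDE.aestronglyMeasurable_stLift_const hf
    (volume.restrict (Ioi (0 : ℝ) ×ˢ univ))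
  have hf₂ : ∀ T : ℝ, 0 < T → ∫⁻ _ in Ioo (0 : ℝ) T, ∫⁻ x, ‖f x‖ₑ ^ 2 < ⊤ := fun T _ =>
    lintegral_force_lt_top hf T
  -- strong convergence at a.e. time along a subsequence `φ`
  obtain ⟨φ, hφ, hae⟩ := hF.exists_strictMono_ae_tendsto_eLpNorm hν hu₀ hfm hf₂ hum hu hcv hT
  have hF' := hF.comp_strictMono hφ
  have hmean' : ∀ n, HasZeroMean ((U ∘ φ) n 0) := fun n => hmean (φ n)
  have hcv' : ∀ t, 0 ≤ t → ∀ k, Tendsto (fun n => mFourierCoeff (EuclideanSpace.complexify ∘ (U ∘ φ) n t) k)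
      atTop (𝓝 (mFourierCoeff (EuclideanSpace.complexify ∘ u t) k)) :=
    fun t ht k => (hcv t ht k).comp hφ.tendsto_atTop
  -- the radius of the `L²`-ball containing all slices up to time `T`
  obtain ⟨A, hA, hFA⟩ := hF'.exists_force_bound hfm hf₂ hT
  set R' : ℝ := Real.sqrt (2 * (∫ x, ‖u₀ x‖ ^ 2) + 4 * T * A.toReal) with hR'def
  have hR'sq : R' ^ 2 = 2 * (∫ x, ‖u₀ x‖ ^ 2) + 4 * T * A.toReal := by
    rw [hR'def, Real.sq_sqrt]
    have : 0 ≤ ∫ x, ‖u₀ x‖ ^ 2 := integral_nonneg fun _ => sq_nonneg _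
    positivity
  have hR' : ∀ n t, 0 ≤ t → t ≤ T → ∫ x, ‖(U ∘ φ) n t x‖ ^ 2 ≤ R' ^ 2 := by
    intro n t ht htT
    rw [hR'sq]
    refine (hF'.integral_norm_sq_le hν.le hT hA n (hFA n) ⟨ht, htT⟩).trans ?_
    have := hF'.initial_bound n
    linarith
  -- TUI at radius `R'`
  obtain ⟨T₀, hT₀, hTUI'⟩ := hTUI R'
  -- the good times
  have hgood : ∀ᵐ s ∂(volume.restrict (Ioo 0 T)),
      (Tendsto (fun j => eLpNorm (U (φ j) s - u s) 2 volume) atTop (𝓝 0) ∧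
        liminf (fun n => eGradNormSq ((U ∘ φ) n s)) atTop < ⊤) ∧ s ∈ Ioo 0 T :=
    (hae.and (ae_liminf_eGradNormSq_lt_top hν hf hu₀ hF' hT)).and (ae_restrict_mem measurableSet_Ioo)
  -- finiteness of the limit dissipation and integrability of the limit work on `(0, T)`
  have hDtop : ∫⁻ τ in Ioo 0 T, eGradNormSq (u τ) < ⊤ := hF.lintegral_eGradNormSq_limit_lt_top hν hu₀ hfm hf₂ hcv hT
  have hWint : IntegrableOn (fun τ => ∫ x, ⟪f x, u τ x⟫_ℝ) (Ioo 0 T) volume :=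
    hF.integrableOn_work_limit hν hu₀ hfm hf₂ hum hu hcv hT
  -- windows (Lemma D) and chaining (Lemmas F, H)
  have hall := chain_of_window (a := 0) (b := T) hT₀ hgood (fun s hs => hs.2)
    (E := fun p q => kineticEnergy (u q) + ν * (∫⁻ τ in Ioo p q, eGradNormSq (u τ)).toReal =
      kineticEnergy (u p) + ∫ τ in p..q, ∫ x, ⟪f x, u τ x⟫_ℝ)
    (fun p q hPp hPq hpq hqT₀ =>
      energyEq_window hν hf hf0 hu₀ hF' hmean' hum hu hcv' hR' hT₀ hTUI' hPp.2.1.le hpq hqT₀ hPq.2.2.le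
        hPp.1.1 hPq.1.1 hPp.1.2)
    (fun p r q hPp _ hPq hpr hrq h₁ h₂ => by
      have hsub : Ioo p q ⊆ Ioo 0 T := Ioo_subset_Ioo hPp.2.1.le hPq.2.2.le
      refine energyEq_trans hpr hrq (ne_top_of_le_ne_top hDtop.ne (lintegral_mono_set hsub)) ?_ ?_ h₁ h₂
      · exact (intervalIntegrable_iff_integrableOn_Ioo_of_le hpr).2
          (hWint.mono_set (Ioo_subset_Ioo hPp.2.1.le ((hrq.trans hPq.2.2.le))))
      · exact (intervalIntegrable_iff_integrableOn_Ioo_of_le hrq).2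
          (hWint.mono_set (Ioo_subset_Ioo (hPp.2.1.le.trans hpr) hPq.2.2.le)))
  filter_upwards [hgood] with t₀ ht₀
  filter_upwards [hgood] with t₁ ht₁
  exact fun h => hall t₀ t₁ ht₀ ht₁ h


/-! ## S14 — the registered stub: TUI(f, ν, ·) ⟹ GEE₀ᵃᵉ(ν, f) -/

/-- **S14 · `stub_galerkinEEaeOfTrajectoryUI` — TUI ⟹ GEE₀ᵃᵉ (lead c7).** If the trajectory-UI statement S1
(`stub_trajectoryUI` of line `enstrophy-ui-transfer`) holds at `(f, ν, R)` for every radius `R`, then every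
coefficientwise limit `u` of a Hopf–Galerkin family of NS(ν, f) with the exact steady force and MEAN-ZERO data
satisfies the energy EQUALITY between a.e. pairs of positive times (`energyEq_ae_horizon` on the horizons
`T = m + 1`, `m ∈ ℕ`). Converse of `TrajectoryUIOfGalerkinEEae.stub_trajectoryUIOfGalerkinEEae` (GEE₀ᵃᵉ ⟹ TUI): the
conjecture-grade leaf of the crux is ONE statement in two currencies, GEE₀ᵃᵉ ⟺ TUI. (The hypotheses `hdiv` and the
strong convergence `h0` at time `0` belong to the registered signature; the a.e. statement does not need them.)
[folklore techniques; the implication is recorded nowhere in print to our knowledge — cf. RobinsonRodrigoSadowski2016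
Thm 4.6 (strong energy inequality for Galerkin limits), FMRT2001 Ch. IV (1.31)] -/
theorem stub_galerkinEEaeOfTrajectoryUI (ν : ℝ) (hν : 0 < ν) (f : T3 → R3) (hf : Torus.IsSmooth f)
    (hdiv : Torus.IsDivFree f) (hf0 : Torus.HasZeroMean f)
    (hTUI : ∀ R : ℝ, ∃ T : ℝ, 0 < T ∧
      ∀ G : ℝ≥0∞, G ≠ ⊤ → ∀ ε : ℝ≥0∞, 0 < ε → ∃ M : ℝ≥0∞, M ≠ ⊤ ∧
        ∀ (N : ℕ) (a : UnitAddTorus (Fin 3) → EuclideanSpace ℝ (Fin 3)),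
          IsGalerkinMode N a → Torus.HasZeroMean a → ∫ x, ‖a x‖ ^ 2 ≤ R ^ 2 →
          Torus.eGradNormSq a ≤ G →
          ∫⁻ t in Set.Ioo 0 T, (Set.Ioi M).indicator id
              (Torus.eGradNormSq (Torus.galerkinFlow ν f N t a)) ≤ ε)
    (u₀ : T3 → R3) (hu₀ : MemLp u₀ 2 volume) (N : ℕ → ℕ) (U : ℕ → ℝ → T3 → R3) (u : ℝ → T3 → R3)
    (hF : IsHopfGalerkinFamily ν (fun _ => f) u₀ N (fun _ _ => f) U)
    (hmean : ∀ n, Torus.HasZeroMean (U n 0))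
    (hum : AEStronglyMeasurable (Torus.stLift u) (volume.restrict (Set.Ioi (0 : ℝ) ×ˢ Set.univ)))
    (hu : ∀ t, 0 ≤ t → MemLp (u t) 2 volume)
    (hcv : ∀ t, 0 ≤ t → ∀ k, Filter.Tendsto
      (fun n => UnitAddTorus.mFourierCoeff (EuclideanSpace.complexify ∘ U n t) k) Filter.atTop
      (𝓝 (UnitAddTorus.mFourierCoeff (EuclideanSpace.complexify ∘ u t) k)))
    (h0 : Filter.Tendsto (fun n => eLpNorm (U n 0 - u 0) 2 volume) Filter.atTop (𝓝 0)) :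
    ∀ᵐ t₀ ∂(volume : Measure ℝ), ∀ᵐ t₁ ∂(volume : Measure ℝ), 0 < t₀ → t₀ ≤ t₁ →
      Torus.kineticEnergy (u t₁) + ν * (∫⁻ τ in Set.Ioo t₀ t₁, Torus.eGradNormSq (u τ)).toReal =
        Torus.kineticEnergy (u t₀) + ∫ τ in t₀..t₁, ∫ x, ⟪f x, u τ x⟫_ℝ := by
  -- registered hypotheses not needed for the a.e. statement
  have _hdiv := hdiv
  have _h0 := h0
  -- the horizons `T = m + 1`
  have hH : ∀ m : ℕ, ∀ᵐ t₀ ∂(volume : Measure ℝ), t₀ ∈ Ioo (0 : ℝ) ((m : ℝ) + 1) →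
      ∀ᵐ t₁ ∂(volume : Measure ℝ), t₁ ∈ Ioo (0 : ℝ) ((m : ℝ) + 1) → t₀ ≤ t₁ →
        kineticEnergy (u t₁) + ν * (∫⁻ τ in Ioo t₀ t₁, eGradNormSq (u τ)).toReal =
          kineticEnergy (u t₀) + ∫ τ in t₀..t₁, ∫ x, ⟪f x, u τ x⟫_ℝ := by
    intro m
    have hT : (0 : ℝ) < (m : ℝ) + 1 := by positivity
    have h := energyEq_ae_horizon hν hf hf0 hTUI hu₀ hF hmean hum hu hcv hT
    rw [ae_restrict_iff' measurableSet_Ioo] at h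
    filter_upwards [h] with t₀ ht₀ hmem
    have h' := ht₀ hmem
    rwa [ae_restrict_iff' measurableSet_Ioo] at h'
  rw [← ae_all_iff] at hH
  filter_upwards [hH] with t₀ ht₀
  have h1 : ∀ m : ℕ, ∀ᵐ t₁ ∂(volume : Measure ℝ), t₀ ∈ Ioo (0 : ℝ) ((m : ℝ) + 1) →
      t₁ ∈ Ioo (0 : ℝ) ((m : ℝ) + 1) → t₀ ≤ t₁ →
        kineticEnergy (u t₁) + ν * (∫⁻ τ in Ioo t₀ t₁, eGradNormSq (u τ)).toReal =
          kineticEnergy (u t₀) + ∫ τ in t₀..t₁, ∫ x, ⟪f x, u τ x⟫_ℝ := by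
    intro m
    by_cases hm : t₀ ∈ Ioo (0 : ℝ) ((m : ℝ) + 1)
    · filter_upwards [ht₀ m hm] with t₁ h
      exact fun _ => h
    · exact Eventually.of_forall fun t₁ h => absurd h hm
  rw [← ae_all_iff] at h1
  filter_upwards [h1] with t₁ ht₁
  intro ht₀pos ht₀₁
  have hm1 : t₁ < (⌊t₁⌋₊ : ℝ) + 1 := Nat.lt_floor_add_one t₁
  exact ht₁ ⌊t₁⌋₊ ⟨ht₀pos, by linarith⟩ ⟨by linarith, hm1⟩ ht₀₁

end Summit.AnomalousDissipation.AnomalousDissipation.Theorems.MomentParityResolvedDissipation.GalerkinEEaeOfTUI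

end
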